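import Mathlib.GroupTheory.IndexNormal
import Literature.IUT.HodgeArakelov.FlTorsorStructureConj
import Literature.IUT.HodgeArakelov.Def23StructuresIff
import Literature.IUT.HodgeArakelov.PlusMinusTowerIndices
import HarnessLib

/-!
# [IUTchII] Def 2.3 (v) — the EXACT INHABITATION CRITERION of the successor interface `FlTorsorStructureConj`:
# an `𝔽^±_l`-torsor structure WITH conjugation action exists iff four group-theoretic facts hold

S. Mochizuki, *Inter-universal Teichmüller theory II*, kurims manuscript (Dec. 2020), §2 Def 2.3 (iii) p. 68, (v) p. 69
(«the images … in `LabCusp^±(Π_⊆)` of the various structures on `LabCusp^±(Π_v)` reviewed in (iii) determine … a natural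
`𝔽^±_l`-torsor structure on `LabCusp^±(Π_⊆)`. Moreover, the natural action of `Π_⊇/Π_⊆` on `Π_⊆` preserves this `𝔽^±_l`-torsor
structure, hence determines a natural outer isomorphism `Π_⊇/Π_⊆ ≅ 𝔽_l^{⋊±}`», «one verifies immediately»); *IUT I* (May 2020)
Def 6.1 (i) p. 155 (`𝔽_l^{⋊±} = 𝔽_l ⋊ {±1}` acting on `𝔽_l` by `z ↦ ±z + λ`) [claim: Mochizuki2012, status: disputed]
(IUTchII §2 Def 2.3 (v), kurims p.69) (D-0012 claim key; record-only; nothing printed is asserted here).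

abc-iut cell, seat abc-iut-w5-d243 gen 4; NV-L6 row «FlTorsorStructureConj-CRITERION» (sequel of p436492 / p437113, GAP-LEDGER
G-w5d243-1).  PROOF-ONLY.  The typed interface `FlTorsorStructure C` (abc-iut-L6-t1) is inhabited iff two iso-DATA exist (w5-d219's
`FlTorsorStructure.nonempty_iff`, p419621: a chart `LabCusp^±(Π̂^±_v) ≃ 𝔽_l` and SOME `Π̂^cor_v/Π̂^±_v ≃* 𝔽_l^{⋊±}` — the action being
read off the chart).  For the SUCCESSOR `FlTorsorStructureConj C` (label action = conjugation) the criterion becomes GENUINELY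
GROUP-THEORETIC (`FlTorsorStructureConj.nonempty_iff_card`):

  `Nonempty (FlTorsorStructureConj C) ↔ ∃ hC : C.ConjStable,` (i) the cusps of `Π̂^±_v` are permuted by `Π̂^cor_v`-conjugation,
  `Nat.card (LabCusp^±(Π̂^±_v)) = l ∧` (ii) they fall into exactly `l` `±`-label classes,
  `[Π̂^cor_v : Π̂^±_v] = 2l ∧` (iii) (cf. Def 2.3 (i): `[Δ̂^cor_v : Δ̂^±_v] = 2l`),
  `∀ g, (∀ t, ⟦g I_t g⁻¹⟧ = ⟦I_t⟧) → g ∈ Π̂^±_v` (iv) only `Π̂^±_v` fixes every label class by conjugation.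

`⟹` is p436492's interface theory (`forall_conjClass_eq_self_iff`, the chart, `quotIso`).  `⟸` is the finite group theory behind
«one verifies immediately»: **a FAITHFUL action of a group of order `2l` (`l` an odd prime) on `l` points is — in a suitable
bijection with `𝔽_l` and through an isomorphism with `𝔽_l^{⋊±}` — the affine action `z ↦ ±z + λ`**
(`exists_equiv_mulEquiv_flPM_of_faithful`: a Cauchy element `r` of order `l` acts as an `l`-cycle, whence a chart with `r ↦ (z ↦ z+1)`;
an element `s ∉ ⟨r⟩` normalises `⟨r⟩` (index `2`), acts by `z ↦ κ z + c` with `κ² = 1`, and `κ = 1` would put `s` in `⟨r⟩` by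
faithfulness, so `s` acts by `z ↦ −z + c`; `⟨r, s⟩ = G` lands in the image of `FlPM.toPerm` (abc-iut-L5-t4's [IUTchI] Def 6.1 (i)
action, `LabelsPlusMinus.lean`), giving `G ≃* 𝔽_l^{⋊±}` by cardinality), followed by p436492's constructor `ofConjClass`.
Consequently the outer isomorphism of Def 2.3 (v) is not extra DATA: it is FORCED by (i)–(iv) (and determined by the chart,
p436492 `quotIso_eq_of_chart_eq`).  Corollary `def23_structuresConj_iff_card`: the strengthened Def 2.3 (iii)–(v) existence
predicate ⟺ `|LabCusp^±(Π_v)| = l` (as a bijection) ∧ (i)–(iv).  This is exactly what a GENUINE producer at the tower of record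
`PlusMinusTower.ofPiCHat` has to supply (law (a) there is w5-d132's p432649); none is claimed here.

No `def`, no instance, no notation, no named fact; typed ≠ proved; no side taken on [IUTchIII] Cor. 3.12; nothing here asserts abc
proved or refuted.
-/

noncomputable section

namespace Literature.IUT.HodgeArakelov

universe u

namespace FlTorsorStructureConj

open Literature.IUT.HodgeTheaters

/-! ## 1. Finite group theory: a faithful action of a group of order `2l` on `l` points is the affine action of `𝔽_l^{⋊±}` -/

section GroupTheory

variable {G X : Type*} [Group G] {l : ℕ}

/-- A permutation `σ` of prime order `l` moving `x₀`: `σ^n` fixes `x₀` only if `l ∣ n`.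
[cite: Mochizuki2012, IUTchI Def 6.1 (i) p.155] -/
theorem dvd_of_pow_apply_eq_self (hl : l.Prime) {σ : Equiv.Perm X} (hσ : orderOf σ = l) {x₀ : X}
    (hx : σ x₀ ≠ x₀) {n : ℕ} (hn : (σ ^ n) x₀ = x₀) : l ∣ n := by
  by_contra hnd
  have hcop : n.Coprime (orderOf σ) := by
    rw [hσ]; exact (Nat.Prime.coprime_iff_not_dvd hl).mpr hnd |>.symm
  obtain ⟨m, hm⟩ := exists_pow_eq_self_of_coprime hcop
  apply hx
  have h : ((σ ^ n) ^ m) x₀ = x₀ := Equiv.Perm.pow_apply_eq_self_of_apply_eq_self hn m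
  rwa [hm] at h

/-- **An element of prime order `l` acting nontrivially on `l` points acts as an `l`-cycle**: there is a bijection
`e : X ≃ 𝔽_l` with `e (σ x) = e x + 1`. [cite: Mochizuki2012, IUTchI Def 6.1 (i) p.155] -/
theorem exists_equiv_translate (hl : l.Prime) (hX : Nat.card X = l) {σ : Equiv.Perm X} (hσ : orderOf σ = l)
    (hσ1 : σ ≠ 1) : ∃ e : X ≃ ZMod l, ∀ x, e (σ x) = e x + 1 := by
  haveI : Fact l.Prime := ⟨hl⟩
  haveI : NeZero l := ⟨hl.ne_zero⟩
  haveI : Finite X := Nat.finite_of_card_ne_zero (by rw [hX]; exact hl.ne_zero)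
  -- a moved point
  obtain ⟨x₀, hx₀⟩ : ∃ x₀, σ x₀ ≠ x₀ := by
    by_contra h
    push Not at h
    exact hσ1 (Equiv.ext h)
  -- the orbit map `a ↦ σ^a x₀`
  let f : ZMod l → X := fun a => (σ ^ a.val) x₀
  have hf_inj : Function.Injective f := by
    have key : ∀ a b : ZMod l, a.val ≤ b.val → f a = f b → a = b := by
      intro a b hab h
      have h' : (σ ^ (b.val - a.val)) x₀ = x₀ := by
        apply (σ ^ a.val).injective
        rw [← Equiv.Perm.mul_apply, ← pow_add, Nat.add_sub_cancel' hab]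
        exact h.symm
      have hd := dvd_of_pow_apply_eq_self hl hσ hx₀ h'
      have hlt : b.val - a.val < l := lt_of_le_of_lt (Nat.sub_le _ _) (ZMod.val_lt b)
      have h0 : b.val - a.val = 0 := Nat.eq_zero_of_dvd_of_lt hd hlt
      exact ZMod.val_injective l (by omega)
    intro a b h
    rcases le_total a.val b.val with hab | hba
    · exact key a b hab h
    · exact (key b a hba h.symm).symm
  have hf_bij : Function.Bijective f :=
    (Nat.bijective_iff_injective_and_card f).mpr ⟨hf_inj, by rw [Nat.card_zmod, hX]⟩
  refine ⟨(Equiv.ofBijective f hf_bij).symm, fun x => ?_⟩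
  obtain ⟨a, rfl⟩ := hf_bij.2 x
  have hval : (a + 1 : ZMod l).val = (a.val + 1) % l := by
    rw [ZMod.val_add, ZMod.val_one]
  have hσf : σ (f a) = f (a + 1) := by
    change σ ((σ ^ a.val) x₀) = (σ ^ (a + 1).val) x₀
    have h2 := pow_mod_orderOf σ (a.val + 1)
    rw [hσ] at h2
    rw [hval, h2, pow_succ', Equiv.Perm.mul_apply]
  rw [hσf, Equiv.ofBijective_symm_apply_apply, Equiv.ofBijective_symm_apply_apply]

/-- If `e (σ x) = e x + 1` then `e (σ^n x) = e x + n`. [cite: Mochizuki2012, IUTchI Def 6.1 (i) p.155] -/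
theorem apply_pow_eq_add {σ : Equiv.Perm X} {e : X ≃ ZMod l} (he : ∀ x, e (σ x) = e x + 1) (n : ℕ) (x : X) :
    e ((σ ^ n) x) = e x + n := by
  induction n with
  | zero => simp
  | succ n ih => rw [pow_succ', Equiv.Perm.mul_apply, he, ih, Nat.cast_succ, add_assoc]

/-- If `e (σ x) = e x + 1` then `e (σ^k x) = e x + k` for `k : ℤ`. [cite: Mochizuki2012, IUTchI Def 6.1 (i) p.155] -/
theorem apply_zpow_eq_add {σ : Equiv.Perm X} {e : X ≃ ZMod l} (he : ∀ x, e (σ x) = e x + 1) (k : ℤ) (x : X) :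
    e ((σ ^ k) x) = e x + k := by
  obtain ⟨n, rfl | rfl⟩ := k.eq_nat_or_neg
  · rw [zpow_natCast, apply_pow_eq_add he, Int.cast_natCast]
  · rw [zpow_neg, zpow_natCast, Int.cast_neg, Int.cast_natCast]
    have h := apply_pow_eq_add he n ((σ ^ n)⁻¹ x)
    rw [Equiv.Perm.inv_def, Equiv.apply_symm_apply] at h
    rw [Equiv.Perm.inv_def, h]; abel

/-- **CLASSIFICATION.** A faithful action `ρ` of a finite group `G` of order `2l`, `l` an odd prime, on a set `X` of `l` points is
the affine action of `𝔽_l^{⋊±}` on `𝔽_l`: there are a bijection `e : X ≃ 𝔽_l` and an isomorphism `φ : G ≃* 𝔽_l^{⋊±}` with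
`e (ρ g x) = φ g • e x` (`= ±(e x) + λ`, abc-iut-L5-t4's [IUTchI] Def 6.1 (i) action).
[cite: Mochizuki2012, IUTchI Def 6.1 (i) p.155] -/
theorem exists_equiv_mulEquiv_flPM_of_faithful [Finite G] (hl : l.Prime) (hl2 : l ≠ 2) (hG : Nat.card G = 2 * l)
    (hX : Nat.card X = l) (ρ : G →* Equiv.Perm X) (hρ : Function.Injective ρ) :
    ∃ (e : X ≃ ZMod l) (φ : G ≃* FlPM l), ∀ g x, e (ρ g x) = φ g • e x := by
  haveI : Fact l.Prime := ⟨hl⟩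
  haveI : NeZero l := ⟨hl.ne_zero⟩
  have hl2' : 2 < l := lt_of_le_of_ne hl.two_le (Ne.symm hl2)
  -- (1) a Cauchy element `r` of order `l`; it acts as an `l`-cycle
  obtain ⟨r, hr⟩ := exists_prime_orderOf_dvd_card' (G := G) l (by rw [hG]; exact dvd_mul_left l 2)
  have hρr : orderOf (ρ r) = l := by rw [orderOf_injective ρ hρ r, hr]
  have hρr1 : ρ r ≠ 1 := by
    intro h
    have : orderOf (ρ r) = 1 := by rw [h, orderOf_one]
    rw [hρr] at this
    exact hl.one_lt.ne' this
  obtain ⟨e, he⟩ := exists_equiv_translate hl hX hρr hρr1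
  have hepow : ∀ (k : ℤ) (x : X), e (ρ (r ^ k) x) = e x + k := fun k x => by
    rw [map_zpow]; exact apply_zpow_eq_add he k x
  -- (2) `H := ⟨r⟩` has index `2`, hence is normal; pick `s ∉ H`
  set H : Subgroup G := Subgroup.zpowers r with hH
  have hHcard : Nat.card H = l := by rw [hH, Nat.card_zpowers, hr]
  have hHidx : H.index = 2 := by
    have h := H.card_mul_index
    rw [hHcard, hG, mul_comm 2 l] at h
    exact Nat.eq_of_mul_eq_mul_left hl.pos h
  haveI hHn : H.Normal := Subgroup.normal_of_index_eq_two hHidx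
  obtain ⟨s, hs⟩ : ∃ s : G, s ∉ H := by
    by_contra h
    push Not at h
    have htop : H = ⊤ := top_le_iff.mp fun g _ => h g
    rw [htop, Subgroup.index_top] at hHidx
    exact absurd hHidx (by decide)
  -- (3) `s r s⁻¹ = r^k`
  obtain ⟨k, hk⟩ : ∃ k : ℤ, r ^ k = s * r * s⁻¹ :=
    Subgroup.mem_zpowers_iff.mp (hHn.conj_mem r (Subgroup.mem_zpowers r) s)
  have hsr : ∀ n : ℤ, s * r ^ n = r ^ (k * n) * s := by
    intro n
    have h : s * r ^ n * s⁻¹ = r ^ (k * n) := by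
      rw [zpow_mul, hk]
      have h' := map_zpow (MulAut.conj s) r n
      simp only [MulAut.conj_apply] at h'
      exact h'
    rw [← h, inv_mul_cancel_right]
  -- the action of `s` through `e`: `z ↦ κ z + c`
  set x₁ : X := e.symm 0 with hx₁
  set c : ZMod l := e (ρ s x₁) with hc
  have hx : ∀ x : X, x = ρ (r ^ ((e x).val : ℤ)) x₁ := by
    intro x
    apply e.injective
    rw [hepow, hx₁, Equiv.apply_symm_apply, zero_add, Int.cast_natCast, ZMod.natCast_zmod_val]
  have hes : ∀ x : X, e (ρ s x) = c + (k : ZMod l) * e x := by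
    intro x
    conv_lhs => rw [hx x, ← Equiv.Perm.mul_apply, ← map_mul, hsr, map_mul, Equiv.Perm.mul_apply, hepow]
    rw [← hc, Int.cast_mul, Int.cast_natCast, ZMod.natCast_zmod_val]
  -- (4) `κ² = 1` from `s² ∈ H`, and `κ ≠ 1` by faithfulness, so `κ = -1`
  obtain ⟨m, hm⟩ : ∃ m : ℤ, r ^ m = s * s := Subgroup.mem_zpowers_iff.mp (Subgroup.mul_self_mem_of_index_two hHidx s)
  have hss : ∀ x : X, e x + m = c + (k : ZMod l) * (c + (k : ZMod l) * e x) := by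
    intro x
    rw [← hepow, hm, map_mul, Equiv.Perm.mul_apply, hes, hes]
  have hκ : (k : ZMod l) * (k : ZMod l) = 1 := by
    have h0 := hss x₁
    have h1 := hss (e.symm 1)
    rw [hx₁, Equiv.apply_symm_apply] at h0
    rw [Equiv.apply_symm_apply] at h1
    rw [zero_add, mul_zero, add_zero] at h0
    -- h1 : 1 + m = c + k * (c + k * 1)   with  h0 : m = c + k * c
    linear_combination h0 - h1
  have hκ' : (k : ZMod l) = -1 := by
    rcases mul_self_eq_one_iff.mp hκ with h | h
    · exfalso
      apply hs
      -- `s` acts like `r ^ c.val`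
      have hsr' : ρ s = ρ (r ^ (c.val : ℤ)) := by
        ext x
        apply e.injective
        rw [hes, h, one_mul, hepow, Int.cast_natCast, ZMod.natCast_zmod_val, add_comm]
      rw [hρ hsr']
      exact Subgroup.zpow_mem_zpowers r _
    · exact h
  rw [hκ'] at hes
  -- (5) the transported action `ρ' : G →* Perm 𝔽_l` lands in the affine group `toPerm (𝔽_l^{⋊±})`
  let ρ' : G →* Equiv.Perm (ZMod l) := e.permCongrHom.toMonoidHom.comp ρ
  have hρ'_apply : ∀ g z, ρ' g z = e (ρ g (e.symm z)) := fun g z => rfl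
  have hρ'_inj : Function.Injective ρ' := e.permCongrHom.injective.comp hρ
  let K : Subgroup G := (FlPM.toPerm l).range.comap ρ'
  have hrK : r ∈ K := by
    refine ⟨FlPM.mk 1 1, Equiv.ext fun z => ?_⟩
    rw [FlPM.toPerm_apply, FlPM.mk_smul, one_smul, hρ'_apply]
    conv_rhs => rw [← zpow_one r, hepow, Equiv.apply_symm_apply, Int.cast_one]
  have hsK : s ∈ K := by
    refine ⟨FlPM.mk c (-1), Equiv.ext fun z => ?_⟩
    rw [FlPM.toPerm_apply, FlPM.mk_smul, hρ'_apply, hes, Equiv.apply_symm_apply, Units.smul_def, Units.val_neg,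
      Units.val_one, neg_one_zsmul, neg_one_mul, add_comm]
  have hHK : H ≤ K := (Subgroup.zpowers_le).mpr hrK
  have hK : K = ⊤ := by
    have hdvd : K.index ∣ 2 := hHidx ▸ Subgroup.index_dvd_of_le hHK
    rcases (Nat.dvd_prime Nat.prime_two).mp hdvd with h1 | h2
    · exact Subgroup.index_eq_one.mp h1
    · exfalso
      apply hs
      haveI : Finite K := inferInstance
      have hKcard : Nat.card K = l := by
        have h := K.card_mul_index
        rw [h2, hG, mul_comm] at h
        exact Nat.eq_of_mul_eq_mul_left two_pos h
      have hHK' : H = K := Subgroup.eq_of_le_of_card_ge hHK (by rw [hKcard, hHcard])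
      rw [hHK']; exact hsK
  have hmem : ∀ g : G, ρ' g ∈ (FlPM.toPerm l).range := fun g => by
    have hg : g ∈ K := by rw [hK]; exact Subgroup.mem_top g
    exact hg
  -- (6) `φ : G ≃* 𝔽_l^{⋊±}` through the injective `toPerm`
  have hι : Function.Injective (FlPM.toPerm l) := FlPM.toPerm_injective hl2'
  let θ : FlPM l ≃* (FlPM.toPerm l).range := MonoidHom.ofInjective hι
  let φ₀ : G →* FlPM l := θ.symm.toMonoidHom.comp (ρ'.codRestrict (FlPM.toPerm l).range hmem)
  have hφ₀ : ∀ g, FlPM.toPerm l (φ₀ g) = ρ' g := fun g =>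
    MonoidHom.apply_ofInjective_symm hι ⟨ρ' g, hmem g⟩
  have hφ₀_inj : Function.Injective φ₀ := by
    intro g g' h
    apply hρ'_inj
    rw [← hφ₀, ← hφ₀, h]
  have hcardFl : Nat.card (FlPM l) = 2 * l := by
    rw [SemidirectProduct.card, Nat.card_congr (Multiplicative.toAdd : Multiplicative (ZMod l) ≃ ZMod l), Nat.card_zmod,
      Nat.card_eq_fintype_card, Fintype.card_units_int, mul_comm]
  haveI : Finite (FlPM l) := Nat.finite_of_card_ne_zero (by rw [hcardFl]; exact mul_ne_zero two_ne_zero hl.ne_zero)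
  have hφ₀_bij : Function.Bijective φ₀ :=
    hφ₀_inj.bijective_of_nat_card_le (by rw [hcardFl, hG])
  refine ⟨e, MulEquiv.ofBijective φ₀ hφ₀_bij, fun g x => ?_⟩
  rw [MulEquiv.ofBijective_apply, ← FlPM.toPerm_apply, hφ₀, hρ'_apply, Equiv.symm_apply_apply]

end GroupTheory

/-! ## 2. The criterion for `FlTorsorStructureConj` -/

variable {S : BadPlaceSetting.{u}} {P : TopGroup.{u}} {T : TemperedCoverings S P} {W : PlusMinusTower T}
  {C : CuspidalInertiaData W}

/-- `|𝔽_l^{⋊±}| = 2l` for the setting's prime. [cite: Mochizuki2012, IUTchI Def 6.1 (i) p.155] -/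
theorem card_flPM : Nat.card (FlPM S.l) = 2 * S.l := by
  rw [SemidirectProduct.card, Nat.card_congr (Multiplicative.toAdd : Multiplicative (ZMod S.l) ≃ ZMod S.l), Nat.card_zmod,
    Nat.card_eq_fintype_card, Fintype.card_units_int, mul_comm]

/-- **NECESSITY**: a successor structure forces (i) law (a), (ii) `l` label classes, (iii) `[Π̂^cor_v : Π̂^±_v] = 2l`, (iv) only
`Π̂^±_v` fixes every class by conjugation. [claim: Mochizuki2012, status: disputed] (IUTchII §2 Def 2.3 (v), kurims p.69) -/
theorem card_conditions (F : FlTorsorStructureConj C) :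
    Nat.card (LabCuspPM C W.pmHat W.pmHat) = S.l ∧ W.pmHat.index = 2 * S.l ∧
      ∀ g : W.Corhat, (∀ t, F.conj_stable.conjClass g t = t) → g ∈ W.pmHat := by
  refine ⟨by rw [Nat.card_congr F.chart, Nat.card_zmod], ?_, fun g => (F.forall_conjClass_eq_self_iff g).mp⟩
  rw [Subgroup.index, Nat.card_congr F.quotIso.toEquiv, card_flPM]

/-- **SUFFICIENCY**: (i)–(iv) produce a successor structure — the conjugation action of `Π̂^cor_v/Π̂^±_v` (order `2l`) on the
`l` label classes is faithful, hence (§1) affine through a chart `LabCusp^±(Π̂^±_v) ≃ 𝔽_l` and an isomorphism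
`Π̂^cor_v/Π̂^±_v ≃* 𝔽_l^{⋊±}`, which p436492's `ofConjClass` packages. [claim: Mochizuki2012, status: disputed] (IUTchII §2 Def 2.3 (v), kurims p.69) -/
theorem nonempty_of_card (hC : C.ConjStable) (hcard : Nat.card (LabCuspPM C W.pmHat W.pmHat) = S.l)
    (hidx : W.pmHat.index = 2 * S.l) (hker : ∀ g : W.Corhat, (∀ t, hC.conjClass g t = t) → g ∈ W.pmHat) :
    Nonempty (FlTorsorStructureConj C) := by
  -- the conjugation action as a homomorphism `Π̂^cor_v →* Perm (LabCusp^±(Π̂^±_v))`, trivial on `Π̂^±_v`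
  let ρ₀ : W.Corhat →* Equiv.Perm (LabCuspPM C W.pmHat W.pmHat) :=
    MonoidHom.mk' (fun g => hC.conjClassEquiv g) fun g g' => Equiv.ext fun t => hC.conjClass_mul g g' t
  have hρ₀ : ∀ g t, ρ₀ g t = hC.conjClass g t := fun _ _ => rfl
  have hle : W.pmHat ≤ ρ₀.ker := fun g hg =>
    (MonoidHom.mem_ker).mpr (Equiv.ext fun t => hC.conjClass_eq_self_of_mem_pmHat hg t)
  let ρ : W.Corhat ⧸ W.pmHat →* Equiv.Perm (LabCuspPM C W.pmHat W.pmHat) := QuotientGroup.lift W.pmHat ρ₀ hle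
  have hρ : ∀ g t, ρ (QuotientGroup.mk g) t = hC.conjClass g t := fun _ _ => rfl
  have hρ_inj : Function.Injective ρ := by
    rw [injective_iff_map_eq_one]
    intro q hq
    obtain ⟨g, rfl⟩ := QuotientGroup.mk_surjective q
    exact (QuotientGroup.eq_one_iff g).mpr (hker g fun t => by rw [← hρ, hq, Equiv.Perm.one_apply])
  -- the quotient is finite of order `2l`
  have hG : Nat.card (W.Corhat ⧸ W.pmHat) = 2 * S.l := hidx
  haveI : Finite (W.Corhat ⧸ W.pmHat) :=
    Nat.finite_of_card_ne_zero (by rw [hG]; exact mul_ne_zero two_ne_zero S.l_prime.ne_zero)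
  obtain ⟨e, φ, heφ⟩ := exists_equiv_mulEquiv_flPM_of_faithful S.l_prime S.l_odd hG hcard ρ hρ_inj
  refine ⟨ofConjClass hC e φ fun g t => ?_⟩
  rw [← hρ, heφ, FlPM.smul_def, Units.smul_def, zsmul_eq_mul, add_comm]

/-- **THE CRITERION** ([IUTchII] Def 2.3 (v) «one verifies immediately», kernel form for the successor interface): an
`𝔽^±_l`-torsor structure on `LabCusp^±(Π̂^±_v)` whose label action IS conjugation EXISTS IFF (i) the cusps of `Π̂^±_v` are permuted
by `Π̂^cor_v`-conjugation, (ii) `|LabCusp^±(Π̂^±_v)| = l`, (iii) `[Π̂^cor_v : Π̂^±_v] = 2l`, (iv) an element fixing every label class by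
conjugation lies in `Π̂^±_v`.  The outer isomorphism `Π̂^cor_v/Π̂^±_v ≅ 𝔽_l^{⋊±}` is then FORCED (and determined by the chart,
p436492 `quotIso_eq_of_chart_eq`). [claim: Mochizuki2012, status: disputed] (IUTchII §2 Def 2.3 (v), kurims p.69) -/
theorem nonempty_iff_card :
    Nonempty (FlTorsorStructureConj C) ↔
      ∃ hC : C.ConjStable, Nat.card (LabCuspPM C W.pmHat W.pmHat) = S.l ∧ W.pmHat.index = 2 * S.l ∧
        ∀ g : W.Corhat, (∀ t, hC.conjClass g t = t) → g ∈ W.pmHat := by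
  constructor
  · rintro ⟨F⟩
    exact ⟨F.conj_stable, F.card_conditions⟩
  · rintro ⟨hC, hcard, hidx, hker⟩
    exact nonempty_of_card hC hcard hidx hker

/-- Condition (iv) restated without the descended action: «`∀ I` cuspidal in `Π̂^±_v`, `⟦g I g⁻¹⟧ = ⟦I⟧`» ⇒ `g ∈ Π̂^±_v`.
[claim: Mochizuki2012, status: disputed] (IUTchII §2 Def 2.3 (v), kurims p.69) -/
theorem nonempty_iff_card' :
    Nonempty (FlTorsorStructureConj C) ↔
      ∃ hC : C.ConjStable, Nat.card (LabCuspPM C W.pmHat W.pmHat) = S.l ∧ W.pmHat.index = 2 * S.l ∧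
        ∀ g : W.Corhat, (∀ (I : Subgroup W.Corhat) (hI : C.IsCuspidalInertia W.pmHat I),
          Quot.mk (labelRel C W.pmHat W.pmHat) ⟨I.map (MulAut.conj g).toMonoidHom, hC g I hI⟩ = Quot.mk _ ⟨I, hI⟩) →
            g ∈ W.pmHat := by
  rw [nonempty_iff_card]
  refine exists_congr fun hC => and_congr_right fun _ => and_congr_right fun _ => forall_congr' fun g => ?_
  constructor
  · intro h hI
    exact h fun t => by
      induction t using Quot.ind with
      | mk I => exact hI I.1 I.2
  · intro h ht
    exact h fun I hI => ht (Quot.mk _ ⟨I, hI⟩)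

/-- **The strengthened Def 2.3 (iii)–(v) existence predicate, numerically**: `Def23_structuresConj Dec C` holds iff
`|LabCusp^±(Π_v)| = l` (as a bijection; w5-d028's `LabCuspStructure.nonempty_iff_nonempty_equiv`, the Def 2.3 (iv) record being
free by w5-d219's `LabelledDecomposition.nonempty`) and (i)–(iv) hold for `Π̂^±_v ⊴ Π̂^cor_v`.
[claim: Mochizuki2012, status: disputed] (IUTchII §2 Def 2.3 (v), kurims p.69) -/
theorem def23_structuresConj_iff_card {D : EtaleThetaData S.toThetaSetting P} (Dec : SubgraphDecomposition S T D) :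
    Def23_structuresConj Dec C ↔
      Nonempty (LabCuspPM C W.piV W.piPM ≃ ZMod S.l) ∧
        ∃ hC : C.ConjStable, Nat.card (LabCuspPM C W.pmHat W.pmHat) = S.l ∧ W.pmHat.index = 2 * S.l ∧
          ∀ g : W.Corhat, (∀ t, hC.conjClass g t = t) → g ∈ W.pmHat := by
  rw [← nonempty_iff_card, ← LabCuspStructure.nonempty_iff_nonempty_equiv]
  constructor
  · rintro ⟨L, -, hF⟩
    exact ⟨⟨L⟩, hF⟩
  · rintro ⟨⟨L⟩, hF⟩
    exact ⟨L, LabelledDecomposition.nonempty Dec L, hF⟩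

end FlTorsorStructureConj

end Literature.IUT.HodgeArakelov

end

/-! ## 3. APPENDIX (append-only): the criterion WITHOUT (iii) — `[Π̂^cor_v : Π̂^±_v] = 2l` holds for every tower (`index_pmHat`) -/

noncomputable section

namespace Literature.IUT.HodgeArakelov

namespace FlTorsorStructureConj

universe u

variable {S : BadPlaceSetting.{u}} {P : TopGroup.{u}} {T : TemperedCoverings S P} {W : PlusMinusTower T} {C : CuspidalInertiaData W}

/-- **THE CRITERION, three conditions** ([IUTchII] Def 2.3 (v), kurims p. 69): the successor structure exists IFF (i) `ConjStable`,
(ii) `|LabCusp^±(Π̂^±_v)| = l`, (iv) only `Π̂^±_v` fixes every label class by conjugation — (iii) of `nonempty_iff_card` is a THEOREM for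
every tower (`PlusMinusTower.index_pmHat`). [claim: Mochizuki2012, status: disputed] (IUTchII §2 Def 2.3 (v), kurims p.69) -/
theorem nonempty_iff_conjStable_card_ker :
    Nonempty (FlTorsorStructureConj C) ↔
      ∃ hC : C.ConjStable, Nat.card (LabCuspPM C W.pmHat W.pmHat) = S.l ∧
        ∀ g : W.Corhat, (∀ t, hC.conjClass g t = t) → g ∈ W.pmHat := by
  rw [nonempty_iff_card]
  exact exists_congr fun _ => ⟨fun h => ⟨h.1, h.2.2⟩, fun h => ⟨h.1, W.index_pmHat, h.2⟩⟩

/-- `Def23_structuresConj Dec C` ⟺ `|LabCusp^±(Π_v)| = l` (as a bijection) ∧ (i) ∧ (ii) ∧ (iv). [claim: Mochizuki2012, status: disputed] (IUTchII §2 Def 2.3 (v), kurims p.69) -/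
theorem def23_structuresConj_iff_conjStable_card_ker {D : EtaleThetaData S.toThetaSetting P} (Dec : SubgraphDecomposition S T D) :
    Def23_structuresConj Dec C ↔
      Nonempty (LabCuspPM C W.piV W.piPM ≃ ZMod S.l) ∧
        ∃ hC : C.ConjStable, Nat.card (LabCuspPM C W.pmHat W.pmHat) = S.l ∧
          ∀ g : W.Corhat, (∀ t, hC.conjClass g t = t) → g ∈ W.pmHat := by
  rw [def23_structuresConj_iff_card, nonempty_iff_card.symm, nonempty_iff_conjStable_card_ker]

end FlTorsorStructureConj

end Literature.IUT.HodgeArakelov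

end
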